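import Literature.Probability.LatticeModels.Correlations
import HarnessLib

/-!
# The Ursell four-point function of an even field: discharge of `connectedFour_eq_ursell_of_odd_vanish`

Companion ("Proofs") file of `Literature/Probability/LatticeModels/Correlations.lean`. That file
defines the Ursell (connected, truncated) `n`-point function `ursell μ φ x` by Möbius inversion over
the lattice of set partitions of `{1, …, n}` (Simon 1993, §II.12, eq. (II.12.3); Glimm–Jaffe 1987,
§4.3, Remark after Cor. 4.3.4, p. 62: `U(i₁,…,i_ν) = ∂^ν ln Z / ∂h_{i₁} ⋯ ∂h_{i_ν}`), the explicit
pairing form `connectedFour μ φ x = ⟨1234⟩ - ⟨12⟩⟨34⟩ - ⟨13⟩⟨24⟩ - ⟨14⟩⟨23⟩` of the connected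
four-point function of an *even* field, and records as a NAMED FACT
`connectedFour_eq_ursell_of_odd_vanish` that the two agree as soon as all odd block moments of
`x : Fin 4 → X` vanish (Glimm–Jaffe 1987, §4.3: "for all `hᵢ = 0` and `ν` odd,
`U(i₁, …, i_ν) = 0`, by the `ξ → -ξ` symmetry", so that only the pair partitions survive in `U₄`).
It is PROVED here; the content is finite combinatorics:

* `Literature.Probability.LatticeModels.pair_sdiff_mem_evenPartsFour` — the two-block partitions
  `{{a, b}, {a, b}ᶜ}` of `Fin 4` are the three pair partitions (`decide`);
* `Literature.Probability.LatticeModels.parts_mem_evenPartsFour_of_forall_even` — a set partition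
  of `Fin 4` all of whose blocks have even size is `{0123}` or one of the three pair partitions
  (`∑_B #B = 4` with every `#B ≥ 2` forces `≤ 2` blocks);
* `Literature.Probability.LatticeModels.exists_finpartition_parts_eq_of_mem_evenPartsFour` —
  conversely each of these four part-sets is a set partition (`decide`);
* `Literature.Probability.LatticeModels.sum_finpartition_fin_four_of_odd_vanish` — hence a sum
  `∑_P g(P.parts)` over all `15` set partitions of `Fin 4` whose summand vanishes whenever some
  block is odd equals `g{0123} + g{01|23} + g{02|13} + g{03|12}`;
* `Literature.Probability.LatticeModels.blockMoment_pair` — `⟨φ_{{i,j}}⟩ = ⟨φ(xᵢ) φ(xⱼ)⟩`;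
* `Literature.Probability.LatticeModels.connectedFour_eq_ursell_of_odd_vanish_holds` — the
  discharge: the Möbius coefficients are `(-1)⁰ 0! = 1` on the one-block partition and
  `(-1)¹ 1! = -1` on the pair partitions.

No new definitions, no named facts; the four even part-sets are written as an explicit `Finset`
literal (no auxiliary `def`). Mathlib anchors: `Finpartition` (with its `Fintype` and `@[ext]`
structure), `Finpartition.sum_card_parts`, `Finpartition.disjoint`, `Finset.card_nsmul_le_sum`,
`Finset.sum_filter_of_ne`, `Finset.sum_image`, `Finset.supIndep` decidability.

## References

* J. Glimm, A. Jaffe, *Quantum Physics: A Functional Integral Point of View*, 2nd ed., Springer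
  (1987), §4.3, Remark after Cor. 4.3.4 (p. 62): Ursell functions, vanishing of odd ones at `h = 0`.
* B. Simon, *The Statistical Mechanics of Lattice Gases* I, Princeton (1993), §II.12,
  eq. (II.12.3): Ursell functions by Möbius inversion over set partitions.
-/

noncomputable section

open MeasureTheory Finset

namespace Literature.Probability.LatticeModels

/-! ### Set partitions of a four-element set into blocks of even size -/

section Partitions

/-- The two-block partitions of `{0, 1, 2, 3}` into a pair `{a, b}` and its complement are exactly
the three pair partitions `{01|23}, {02|13}, {03|12}`; stated as membership of the part-set in the
explicit list of the four even part-sets (the first entry `{0123}` being the one-block partition).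
Elementary enumeration (`decide`). [folklore] -/
theorem pair_sdiff_mem_evenPartsFour : ∀ a b : Fin 4, a ≠ b →
    ({({a, b} : Finset (Fin 4)), univ \ {a, b}} : Finset (Finset (Fin 4))) ∈
      ({{univ}, {{0, 1}, {2, 3}}, {{0, 2}, {1, 3}}, {{0, 3}, {1, 2}}} :
        Finset (Finset (Finset (Fin 4)))) := by
  decide

/-- A set partition of `{0, 1, 2, 3}` all of whose blocks have even cardinality is either the
one-block partition `{0123}` or one of the three pair partitions `{01|23}, {02|13}, {03|12}`:
since `∑_B #B = 4` and every block has `#B ≥ 2`, there are at most two blocks, and two blocks are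
a pair and its complement (Simon 1993, §II.12, the `n = 4` case of the Ursell expansion).
[folklore] -/
theorem parts_mem_evenPartsFour_of_forall_even (P : Finpartition (univ : Finset (Fin 4)))
    (heven : ∀ B ∈ P.parts, Even #B) :
    P.parts ∈ ({{univ}, {{0, 1}, {2, 3}}, {{0, 2}, {1, 3}}, {{0, 3}, {1, 2}}} :
      Finset (Finset (Finset (Fin 4)))) := by
  have hsum : ∑ B ∈ P.parts, #B = 4 := by
    rw [P.sum_card_parts, card_univ, Fintype.card_fin]
  have hge : ∀ B ∈ P.parts, 2 ≤ #B := fun B hB => by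
    have hpos : 0 < #B := (P.nonempty_of_mem_parts hB).card_pos
    obtain ⟨r, hr⟩ := heven B hB
    omega
  have hle : #P.parts * 2 ≤ 4 := by
    have h := Finset.card_nsmul_le_sum P.parts (fun B => #B) 2 hge
    rwa [hsum, smul_eq_mul] at h
  have hpos : 0 < #P.parts := by
    rcases P.parts.eq_empty_or_nonempty with h | h
    · rw [h, sum_empty] at hsum
      omega
    · exact h.card_pos
  have hcard : #P.parts = 1 ∨ #P.parts = 2 := by omega
  rcases hcard with h1 | h2
  · -- one block: it is the whole set
    obtain ⟨B, hB⟩ := Finset.card_eq_one.1 h1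
    have hsup : P.parts.sup id = univ := P.sup_parts
    rw [hB, sup_singleton, id_eq] at hsup
    rw [hB, hsup]
    decide
  · -- two blocks: a pair and its complement
    obtain ⟨B, C, hBC, hP⟩ := Finset.card_eq_two.1 h2
    have hsup : P.parts.sup id = univ := P.sup_parts
    simp only [hP, sup_insert, sup_singleton, id_eq, sup_eq_union] at hsup
    have hB : B ∈ P.parts := by rw [hP]; exact mem_insert_self _ _
    have hC : C ∈ P.parts := by rw [hP]; exact mem_insert_of_mem (mem_singleton_self _)
    have hdisj : Disjoint B C := P.disjoint hB hC hBC
    have hC' : C = univ \ B := by rw [← hsup, union_sdiff_cancel_left hdisj]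
    have h4 : #B + #C = 4 := by rwa [hP, sum_pair hBC] at hsum
    have hB2 : #B = 2 := by
      have := hge B hB
      have := hge C hC
      omega
    obtain ⟨a, b, hab, rfl⟩ := Finset.card_eq_two.1 hB2
    rw [hP, hC']
    exact pair_sdiff_mem_evenPartsFour a b hab

/-- Conversely, each of the four even part-sets `{0123}, {01|23}, {02|13}, {03|12}` is the set of
blocks of a set partition of `{0, 1, 2, 3}` with all blocks of even cardinality (supremum
independence, covering and non-emptiness checked by `decide`). [folklore] -/
theorem exists_finpartition_parts_eq_of_mem_evenPartsFour (ps : Finset (Finset (Fin 4)))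
    (hps : ps ∈ ({{univ}, {{0, 1}, {2, 3}}, {{0, 2}, {1, 3}}, {{0, 3}, {1, 2}}} :
      Finset (Finset (Finset (Fin 4))))) :
    ∃ P : Finpartition (univ : Finset (Fin 4)), (∀ B ∈ P.parts, Even #B) ∧ P.parts = ps := by
  simp only [mem_insert, mem_singleton] at hps
  rcases hps with rfl | rfl | rfl | rfl
  · exact ⟨⟨_, by decide, by decide, by decide⟩, by decide, rfl⟩
  · exact ⟨⟨_, by decide, by decide, by decide⟩, by decide, rfl⟩
  · exact ⟨⟨_, by decide, by decide, by decide⟩, by decide, rfl⟩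
  · exact ⟨⟨_, by decide, by decide, by decide⟩, by decide, rfl⟩

/-- The set partitions of `{0, 1, 2, 3}` with all blocks even, as a filter of the `Fintype` of all
`15` set partitions, map bijectively under `Finpartition.parts` onto the four even part-sets
`{0123}, {01|23}, {02|13}, {03|12}`. [folklore] -/
theorem image_parts_filter_forall_even_eq_evenPartsFour :
    ((univ : Finset (Finpartition (univ : Finset (Fin 4)))).filter
        (fun P => ∀ B ∈ P.parts, Even #B)).image Finpartition.parts =
      ({{univ}, {{0, 1}, {2, 3}}, {{0, 2}, {1, 3}}, {{0, 3}, {1, 2}}} :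
        Finset (Finset (Finset (Fin 4)))) := by
  ext ps
  simp only [mem_image, mem_filter, mem_univ, true_and]
  constructor
  · rintro ⟨P, hP, rfl⟩
    exact parts_mem_evenPartsFour_of_forall_even P hP
  · intro h
    obtain ⟨P, hP, rfl⟩ := exists_finpartition_parts_eq_of_mem_evenPartsFour ps h
    exact ⟨P, hP, rfl⟩

/-- **Möbius sum over the partitions of a four-element set with odd blocks killed.** If a function
`g` of the part-set vanishes on every set partition of `{0, 1, 2, 3}` having a block of odd
cardinality, then its sum over all `15` set partitions reduces to the four even ones:
`∑_P g(P) = g{0123} + g{01|23} + g{02|13} + g{03|12}`. This is the combinatorial content of the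
reduction of the Ursell function `u₄` of an even field to the pairing formula (Glimm–Jaffe 1987,
§4.3, Remark after Cor. 4.3.4; Simon 1993, §II.12). [folklore] -/
theorem sum_finpartition_fin_four_of_odd_vanish {M : Type*} [AddCommMonoid M]
    (g : Finset (Finset (Fin 4)) → M)
    (hg : ∀ P : Finpartition (univ : Finset (Fin 4)), ∀ B ∈ P.parts, ¬Even #B → g P.parts = 0) :
    ∑ P : Finpartition (univ : Finset (Fin 4)), g P.parts =
      g {univ} + g {{0, 1}, {2, 3}} + g {{0, 2}, {1, 3}} + g {{0, 3}, {1, 2}} := by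
  have h1 : ∑ P : Finpartition (univ : Finset (Fin 4)), g P.parts =
      ∑ P ∈ (univ : Finset (Finpartition (univ : Finset (Fin 4)))).filter
        (fun P => ∀ B ∈ P.parts, Even #B), g P.parts := by
    refine (Finset.sum_filter_of_ne fun P _ hP => ?_).symm
    by_contra hE
    push Not at hE
    obtain ⟨B, hB, hBo⟩ := hE
    exact hP (hg P B hB hBo)
  have h2 : ∑ P ∈ (univ : Finset (Finpartition (univ : Finset (Fin 4)))).filter
        (fun P => ∀ B ∈ P.parts, Even #B), g P.parts =
      ∑ ps ∈ ((univ : Finset (Finpartition (univ : Finset (Fin 4)))).filter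
        (fun P => ∀ B ∈ P.parts, Even #B)).image Finpartition.parts, g ps :=
    (Finset.sum_image fun P _ Q _ h => Finpartition.ext h).symm
  have hT₁ : ({univ} : Finset (Finset (Fin 4))) ∉
      ({{{0, 1}, {2, 3}}, {{0, 2}, {1, 3}}, {{0, 3}, {1, 2}}} :
        Finset (Finset (Finset (Fin 4)))) := by decide
  have hT₂ : ({{0, 1}, {2, 3}} : Finset (Finset (Fin 4))) ∉
      ({{{0, 2}, {1, 3}}, {{0, 3}, {1, 2}}} : Finset (Finset (Finset (Fin 4)))) := by decide
  have hT₃ : ({{0, 2}, {1, 3}} : Finset (Finset (Fin 4))) ∉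
      ({{{0, 3}, {1, 2}}} : Finset (Finset (Finset (Fin 4)))) := by decide
  rw [h1, h2, image_parts_filter_forall_even_eq_evenPartsFour, sum_insert hT₁, sum_insert hT₂,
    sum_insert hT₃, sum_singleton]
  simp only [add_assoc]

end Partitions

/-! ### The discharge -/

section Generic

variable {Ω X : Type*} [MeasurableSpace Ω]

/-- The block moment of a two-element block is the two-point function:
`⟨φ_{{i, j}}⟩ = ⟨φ(xᵢ) φ(xⱼ)⟩` for `i ≠ j` (Simon 1993, §II.12; Glimm–Jaffe 1987, §4.2).
[cite: GlimmJaffe1987, §4.2] -/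
theorem blockMoment_pair (μ : Measure Ω) (φ : X → Ω → ℝ) {n : ℕ} (x : Fin n → X) {i j : Fin n}
    (hij : i ≠ j) : blockMoment μ φ x {i, j} = twoPoint μ φ (x i) (x j) := by
  simp only [blockMoment, twoPoint, prod_pair hij]

/-- **Discharge of the named fact `connectedFour_eq_ursell_of_odd_vanish`** (`Correlations.lean`):
if all block moments `⟨φ_B⟩`, `B ⊆ {1, 2, 3, 4}` of odd cardinality, vanish (e.g. for an even
measure at zero field, by the `ξ → -ξ` symmetry), then the Ursell four-point function
`u₄ = ∑_P (-1)^{|P|-1} (|P|-1)! ∏_{B ∈ P} ⟨φ_B⟩` reduces to the pairing formula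
`⟨1234⟩ - ⟨12⟩⟨34⟩ - ⟨13⟩⟨24⟩ - ⟨14⟩⟨23⟩`: of the `15` set partitions of a four-element set only
`{1234}` (coefficient `(-1)⁰ 0! = 1`) and the three pair partitions (coefficient
`(-1)¹ 1! = -1`) have no odd block (Glimm–Jaffe 1987, §4.3, Remark after Cor. 4.3.4, p. 62;
Simon 1993, §II.12, eq. (II.12.3)). No integrability hypothesis is needed: both sides are built
from the same Bochner integrals. [cite: GlimmJaffe1987, §4.3, Remark after Cor. 4.3.4 (p. 62)] -/
theorem connectedFour_eq_ursell_of_odd_vanish_holds :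
    connectedFour_eq_ursell_of_odd_vanish (Ω := Ω) (X := X) := by
  intro μ φ x hodd
  -- the Möbius summand as a function of the part-set
  set g : Finset (Finset (Fin 4)) → ℝ := fun ps =>
    (-1 : ℝ) ^ (#ps - 1) * ((#ps - 1).factorial : ℝ) * ∏ B ∈ ps, blockMoment μ φ x B with hg
  have hurs : ursell μ φ x = ∑ P : Finpartition (univ : Finset (Fin 4)), g P.parts := by
    simp only [hg, ursell]
  -- partitions with an odd block do not contribute
  have hzero : ∀ P : Finpartition (univ : Finset (Fin 4)), ∀ B ∈ P.parts, ¬Even #B →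
      g P.parts = 0 := by
    intro P B hB hBo
    simp only [hg, prod_eq_zero hB (hodd B (Nat.not_even_iff_odd.mp hBo)), mul_zero]
  -- the values of the summand on the four even part-sets
  have hone : g {univ} = nPoint μ φ x := by
    simp [hg, blockMoment_univ]
  have hpair : ∀ B C : Finset (Fin 4), B ≠ C →
      g {B, C} = -(blockMoment μ φ x B * blockMoment μ φ x C) := by
    intro B C hBC
    simp [hg, card_pair hBC, prod_pair hBC]
  have h01 : (({0, 1} : Finset (Fin 4)) ≠ {2, 3}) := by decide
  have h02 : (({0, 2} : Finset (Fin 4)) ≠ {1, 3}) := by decide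
  have h03 : (({0, 3} : Finset (Fin 4)) ≠ {1, 2}) := by decide
  rw [hurs, sum_finpartition_fin_four_of_odd_vanish g hzero, hone, hpair _ _ h01, hpair _ _ h02,
    hpair _ _ h03, blockMoment_pair μ φ x (show (0 : Fin 4) ≠ 1 by decide),
    blockMoment_pair μ φ x (show (2 : Fin 4) ≠ 3 by decide),
    blockMoment_pair μ φ x (show (0 : Fin 4) ≠ 2 by decide),
    blockMoment_pair μ φ x (show (1 : Fin 4) ≠ 3 by decide),
    blockMoment_pair μ φ x (show (0 : Fin 4) ≠ 3 by decide),
    blockMoment_pair μ φ x (show (1 : Fin 4) ≠ 2 by decide)]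
  simp only [connectedFour]
  ring

end Generic

end Literature.Probability.LatticeModels
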